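import Summits.ABC.IUTFork.LDHCor312
import Summits.ABC.IUTFork.LDHValLine
import HarnessLib

/-!
# The fork at [IUTchIII] Corollary 3.12, L-DH level (c312-3), III-b: non-vacuity — (1.1) is independent
# of the L-DH typing

Record-only file (D-0012) of the abc-iut cell (seat abc-iut-c312-3); TAKES NO SIDE. VACUITY AUDIT of the
L-DH hypothesis structures (cell rule: "vacuity-audit every fork-level hypothesis (LANA Rem 8.2.1) with a
non-vacuity witness as skel/ForkChecks does"), over the valuation line `valLine F` of `LDHValLine`. For
EVERY number field `F` and EVERY pilot data `(F, j_E, S, l)` we build `DHData` (so `DHData F` is inhabited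
whenever `PilotData F` is) and compute Dupuy–Hilado's (1.1) (`DHData.Cor312DH`) in it:

* `shellWitness X` — `(O_𝕃(−P_Θ))^{Ind3} := I = O` (the largest region the bound (4.10) allows here):
  PROVED `cor312DH_shellWitness` — (1.1) HOLDS (`−|log Θ| = 0 ≥ −deĝ̲(P_q)`).
* `bareWitness X` — `(O_𝕃(−P_Θ))^{Ind3} := O_𝕃(−P_Θ)` (no (Ind3) enlargement): PROVED
  `not_cor312DH_bareWitness` — (1.1) FAILS, provided every prime under `S` has a single place of `F` over it
  (then (Ind1), which moves the scaled tensor factor, produces no inflation either; `F = ℚ`: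
  `placesOver_subsingleton_of_finrank_eq_one`). Without that proviso the valuation line exhibits the one
  genuine L-DH-level effect of (Ind1): in the summand `(v_0,…,v_j)` the union over permutations replaces
  the endpoint at `v_j` by the minimum over `v_0,…,v_j` (`hullUTheta_bare`).
* `exists_pilotData_rat`, `cor312DH_independent`: over `ℚ` (`j_E = 1/5`, `S` = the place over `5`, `l = 5`)
  both truth values occur — UNCONDITIONALLY.

So at the L-DH level (1.1) is neither vacuous nor a consequence of the typing: its truth value is decided
by what (Ind3) and the hull do to `O_𝕃(−P_Θ)` — the kernel-visible form of `LDHCor312.cor312DH_iff_inflation`,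
now over constructed objects. SCOPE OF THE WITNESS (referee ref-b, PASS-B4): the valuation line has TRIVIAL
(Ind2) and hull and an identity (Ind1)-transport (the (Ind1) re-indexing of tuples is genuine — it produces
the `min` of `hullUTheta_bare` — but carries no arithmetic); it witnesses satisfiability of the interfaces and
the independence of (1.1) from them, and NOTHING about the real tensor-packet containers.
[cite: DupuyHilado2025, §1 (1.1), §3.4, §3.7, §4.10–4.12] [claim: Mochizuki2012, status: disputed]
Deliberately NOT here: any `p`-adic content; any judgement.
-/

noncomputable section

open Set Finset

namespace Summit.ABC.IUTFork

open Literature.IUT.LogVolume NumberField IsDedekindDomain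
open scoped Pointwise

variable (F : Type) [Field F] [NumberField F]

/-! ## 2. Two `DHData` over any pilot data; (1.1) true in one, false in the other -/

namespace ValLine

variable {F} (X : PilotData F)

/-- The primes under the bad places `S`. [folklore] -/
def primesUnder : Finset ℕ := X.S.image (residueChar F)

/-- They are primes. [folklore] -/
theorem primesUnder_prime : ∀ p ∈ primesUnder X, p.Prime := by
  intro p hp
  obtain ⟨v, _, rfl⟩ := Finset.mem_image.mp hp
  exact residueChar_prime F v

/-- They contain the residue characteristic of every `v ∈ S`. [folklore] -/
theorem mem_primesUnder {v : HeightOneSpectrum (𝓞 F)} (hv : v ∈ X.S) : residueChar F v ∈ primesUnder X :=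
  Finset.mem_image_of_mem _ hv

/-- The theta-idele of the valuation line: `t_{Θ,j,v} :=` the coefficient of `P_{Θ,j}` at `v`.
[cite: DupuyHilado2025, §3.9] -/
def tΘ : (valLine F).LgpIdele X.lstar := fun i _ v => X.thetaPilot i v.1

/-- The `q`-idele of the valuation line: the coefficient of `P_q` at `v`. [cite: DupuyHilado2025, §3.9] -/
def tq : (valLine F).LgpIdele X.lstar := fun _ _ v => X.qPilot v.1

/-- The coefficients of `P_{Θ,j}` are `≥ 0`. [folklore] -/
theorem thetaPilot_nonneg (i : Fin X.lstar) (v : HeightOneSpectrum (𝓞 F)) : 0 ≤ X.thetaPilot i v := by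
  classical
  show 0 ≤ (∑ w ∈ X.S, FinDivisor.of w ((((i : ℕ) + 1 : ℝ) ^ 2) * (X.ordq w : ℝ) / (2 * X.l))) v
  rw [Finsupp.finsetSum_apply]
  refine Finset.sum_nonneg fun w hw => ?_
  rw [FinDivisor.of, Finsupp.single_apply]
  split_ifs
  · have := X.ordq_pos hw
    have := X.two_mul_l_pos
    positivity
  · exact le_rfl

/-- (Ind3)-datum A: `(O_𝕃(−P_Θ))^{Ind3} := I = O = [0,∞)` in every summand — allowed by (4.10) (`n = 0`).
[cite: DupuyHilado2025, §4.10] -/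
def ind3Shell : (valLine F).Ind3Datum (tΘ X) where
  bare3 := (valLine F).O
  bare3_adm := (valLine F).O_adm
  region_subset p j e := by
    obtain ⟨b, hb, hb'⟩ := region_eq_Ici F (tΘ X) p j e
    rw [hb]
    show Set.Ici b ⊆ Set.Ici (0 : ℝ)
    apply Set.Ici_subset_Ici.mpr
    rcases hb' with rfl | ⟨h, rfl⟩
    · exact le_rfl
    · exact mul_nonneg (thetaPilot_nonneg X _ _) (c_pos F _).le
  subset_bound p i e := by
    intro x hx
    refine Set.mem_iUnion.mpr ⟨0, ?_⟩
    simpa using hx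

/-- (Ind3)-datum B: `(O_𝕃(−P_Θ))^{Ind3} := O_𝕃(−P_Θ)` — no enlargement (allowed by (4.10), `n = 1`).
[cite: DupuyHilado2025, §4.10] -/
def ind3Bare : (valLine F).Ind3Datum (tΘ X) where
  bare3 := (valLine F).region (tΘ X)
  bare3_adm := (valLine F).region_adm (tΘ X)
  region_subset _ _ _ := Subset.rfl
  subset_bound p i e := by
    intro x hx
    refine Set.mem_iUnion.mpr ⟨1, ?_⟩
    rw [Function.iterate_one]
    rw [(valLine F).region_succ (tΘ X) i p e] at hx
    exact hx

/-- In the valuation line every possible image of a region `B` is, in the summand `v⃗`, the component of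
`B` at `v⃗ ∘ σ` ((Ind1) = identity transport, (Ind2) trivial). [folklore] -/
theorem UTheta_eq {D3 : (valLine F).Ind3Datum (tΘ X)} (lam : (valLine F).Ind2Elt × (valLine F).Ind1Elt)
    (p j : ℕ) (e : Fin (j + 1) → placesOver F p) :
    (valLine F).UTheta D3 lam p j e = D3.bare3 p j (e ∘ lam.2 j) := by
  simp only [IndPacketModel.UTheta, IndPacketModel.ind2, IndPacketModel.ind1]
  show (fun x : ℝ => x) '' ((Equiv.refl ℝ) '' _) = _
  simp

/-- With datum A, `U_Θ = O` and `hull(U_Θ) = O`. [folklore] -/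
theorem hullUTheta_shell : (valLine F).hullUTheta (ind3Shell X) = (valLine F).O := by
  funext p j e
  show (ClosureOperator.id (Set ℝ)) (⋃ lam, (valLine F).UTheta (ind3Shell X) lam p j e) = Set.Ici 0
  simp only [ClosureOperator.id_apply, UTheta_eq]
  apply Set.eq_of_subset_of_subset
  · exact Set.iUnion_subset fun _ => Subset.rfl
  · exact Set.subset_iUnion_of_subset ((fun _ _ _ => (1 : Unit)), (fun _ => 1)) Subset.rfl

/-- **Witness A** (`DHData` with `(O_𝕃(−P_Θ))^{Ind3} = O`). [cite: DupuyHilado2025, §4.10–4.12] -/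
def shellWitness : DHData F where
  X := X
  M := valLine F
  T := primesUnder X
  T_prime := primesUnder_prime X
  S_sub _ hv := mem_primesUnder X hv
  tΘ := tΘ X
  tΘ_ord _ _ _ := rfl
  tq := tq X
  tq_ord _ _ _ := rfl
  ind3 := ind3Shell X
  hull_adm := by rw [hullUTheta_shell]; exact (valLine F).O_adm

/-- **(1.1) HOLDS in witness A**: `−|log Θ| = ln ν̄_𝕃(O) = 0 ≥ −deĝ̲(P_q)`.
[claim: Mochizuki2012, status: disputed] -/
theorem cor312DH_shellWitness : (shellWitness X).Cor312DH := by
  show -FinDivisor.ndeg F X.qPilot ≤ (valLine F).lnνL X.lstar (primesUnder X) ((valLine F).hullUTheta (ind3Shell X))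
  rw [hullUTheta_shell]
  have h0 : (valLine F).lnνL X.lstar (primesUnder X) (valLine F).O = 0 := by
    refine Finset.sum_eq_zero fun p _ => ?_
    rw [PacketModel.lnνLp, Finset.sum_eq_zero (fun i _ => (valLine F).lnνTensorPower_O p _), mul_zero]
  rw [h0, neg_nonpos, FinDivisor.ndeg_apply]
  exact div_nonneg X.deg_qPilot_pos.le FinDivisor.finrank_pos.le

/-- Every component of `O_𝕃(−div t)` is a ray; name its endpoint. [folklore] -/
theorem region_ray {lstar : ℕ} (t : (valLine F).LgpIdele lstar) (p j : ℕ)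
    (e : Fin (j + 1) → placesOver F p) : ∃ b : ℝ, (valLine F).region t p j e = Set.Ici b := by
  obtain ⟨b, hb, _⟩ := region_eq_Ici F t p j e
  exact ⟨b, hb⟩

/-- The endpoint of the ray `O_𝕃(−div t)_{v⃗}`. [folklore] -/
def rayEnd {lstar : ℕ} (t : (valLine F).LgpIdele lstar) (p j : ℕ) (e : Fin (j + 1) → placesOver F p) : ℝ :=
  Classical.choose (region_ray (F := F) t p j e)

/-- `O_𝕃(−div t)_{v⃗} = [rayEnd, ∞)`. [folklore] -/
theorem region_eq_rayEnd {lstar : ℕ} (t : (valLine F).LgpIdele lstar) (p j : ℕ)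
    (e : Fin (j + 1) → placesOver F p) : (valLine F).region t p j e = Set.Ici (rayEnd t p j e) :=
  Classical.choose_spec (region_ray (F := F) t p j e)

/-- With datum B, the union of the possible images in the summand `v⃗` is the union over permutations `σ`
of the rays `O_𝕃(−P_Θ)_{v⃗∘σ}` — (Ind1) moves the scaled tensor factor. [cite: DupuyHilado2025, §4.7, §4.11] -/
theorem iUnion_UTheta_bare (p j : ℕ) (e : Fin (j + 1) → placesOver F p) :
    (⋃ lam, (valLine F).UTheta (ind3Bare X) lam p j e) =
      ⋃ σ : Equiv.Perm (Fin (j + 1)), (valLine F).region (tΘ X) p j (e ∘ σ) := by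
  apply Set.eq_of_subset_of_subset
  · refine Set.iUnion_subset fun lam => ?_
    rw [UTheta_eq]
    exact Set.subset_iUnion (fun σ : Equiv.Perm (Fin (j + 1)) => (valLine F).region (tΘ X) p j (e ∘ σ))
      (lam.2 j)
  · refine Set.iUnion_subset fun σ => ?_
    refine Set.subset_iUnion_of_subset
      ((fun _ _ _ => (1 : Unit)), Function.update (fun j' => (1 : Equiv.Perm (Fin (j' + 1)))) j σ) ?_
    rw [UTheta_eq]
    show _ ⊆ (valLine F).region (tΘ X) p j (e ∘ (Function.update (fun j' => (1 : Equiv.Perm (Fin (j' + 1)))) j σ j))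
    rw [Function.update_self]

/-- … which is again a ray (a finite union of rays). [folklore] -/
theorem iUnion_perm_region_eq (p j : ℕ) (e : Fin (j + 1) → placesOver F p) :
    (⋃ σ : Equiv.Perm (Fin (j + 1)), (valLine F).region (tΘ X) p j (e ∘ σ)) =
      Set.Ici ((Finset.univ : Finset (Equiv.Perm (Fin (j + 1)))).inf' ⟨1, Finset.mem_univ _⟩
        (fun σ : Equiv.Perm (Fin (j + 1)) => rayEnd (tΘ X) p j (e ∘ σ))) := by
  ext x
  rw [Set.mem_iUnion, Set.mem_Ici, Finset.inf'_le_iff]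
  constructor
  · rintro ⟨σ, h⟩
    rw [region_eq_rayEnd, Set.mem_Ici] at h
    exact ⟨σ, Finset.mem_univ _, h⟩
  · rintro ⟨σ, -, h⟩
    refine ⟨σ, ?_⟩
    rw [region_eq_rayEnd, Set.mem_Ici]
    exact h

/-- With datum B, `hull(U_Θ)_{v⃗}` is the ray over the minimum endpoint. [folklore] -/
theorem hullUTheta_bare (p j : ℕ) (e : Fin (j + 1) → placesOver F p) :
    (valLine F).hullUTheta (ind3Bare X) p j e =
      Set.Ici ((Finset.univ : Finset (Equiv.Perm (Fin (j + 1)))).inf' ⟨1, Finset.mem_univ _⟩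
        (fun σ : Equiv.Perm (Fin (j + 1)) => rayEnd (tΘ X) p j (e ∘ σ))) := by
  show (ClosureOperator.id (Set ℝ)) (⋃ lam, (valLine F).UTheta (ind3Bare X) lam p j e) = _
  rw [ClosureOperator.id_apply, iUnion_UTheta_bare, iUnion_perm_region_eq]

/-- **Witness B** (`DHData` with `(O_𝕃(−P_Θ))^{Ind3} = O_𝕃(−P_Θ)`): no (Ind3) enlargement; (Ind1) still
acts. [cite: DupuyHilado2025, §4.10–4.12] -/
def bareWitness : DHData F where
  X := X
  M := valLine F
  T := primesUnder X
  T_prime := primesUnder_prime X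
  S_sub _ hv := mem_primesUnder X hv
  tΘ := tΘ X
  tΘ_ord _ _ _ := rfl
  tq := tq X
  tq_ord _ _ _ := rfl
  ind3 := ind3Bare X
  hull_adm p j e := by
    rw [hullUTheta_bare]
    exact ⟨_, rfl⟩

/-- If a prime has a single place of `F` over it, tuples of places over it are constant, so (Ind1) moves
nothing there. [folklore] -/
theorem comp_perm_eq_of_subsingleton {p j : ℕ} (h : ∀ v w : placesOver F p, v = w)
    (e : Fin (j + 1) → placesOver F p) (σ : Equiv.Perm (Fin (j + 1))) : e ∘ σ = e :=
  funext fun _ => h _ _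

/-- `ln ν̄_{𝕃_p}` only sees the components over `p`. [folklore] -/
theorem lnνLp_congr {M : PacketModel F} (lstar p : ℕ) {A B : M.Region} (h : ∀ j e, A p j e = B p j e) :
    M.lnνLp lstar p A = M.lnνLp lstar p B := by
  simp [PacketModel.lnνLp, PacketModel.lnνTensorPower, h]

/-- **(1.1) FAILS in witness B when every prime under `S` has a single place of `F` over it**: then
`hull(U_Θ) = O_𝕃(−P_Θ)` over `T`, so `−|log Θ| = −deĝ̲_lgp(P_Θ) < −deĝ̲(P_q)` (no inflation at all; the
skeleton's `not_cor312_of_bare` over constructed objects). [claim: Mochizuki2012, status: disputed] -/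
theorem not_cor312DH_bareWitness (h : ∀ p ∈ primesUnder X, ∀ v w : placesOver F p, v = w) :
    ¬ (bareWitness X).Cor312DH := by
  have hhull : (valLine F).lnνL X.lstar (primesUnder X) ((valLine F).hullUTheta (ind3Bare X)) =
      (valLine F).lnνL X.lstar (primesUnder X) ((valLine F).region (tΘ X)) := by
    unfold PacketModel.lnνL
    refine Finset.sum_congr rfl fun p hp => lnνLp_congr _ _ fun j e => ?_
    rw [hullUTheta_bare, region_eq_rayEnd]
    congr 1
    have hconst : (fun σ : Equiv.Perm (Fin (j + 1)) => rayEnd (tΘ X) p j (e ∘ σ)) =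
        fun _ => rayEnd (tΘ X) p j e := by
      funext σ; rw [comp_perm_eq_of_subsingleton (h p hp)]
    rw [hconst]
    exact Finset.inf'_const _ _
  have hΘ : (valLine F).lnνL X.lstar (primesUnder X) ((valLine F).region (tΘ X)) =
      -LgpDivisor.ndegLgp X.thetaPilot := (bareWitness X).lnνL_regionΘ
  have hlt : FinDivisor.ndeg F X.qPilot < LgpDivisor.ndegLgp X.thetaPilot := by
    rw [FinDivisor.ndeg_apply, LgpDivisor.ndegLgp_eq]
    exact div_lt_div_of_pos_right X.deg_qPilot_lt_degLgp_thetaPilot FinDivisor.finrank_pos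
  intro hc
  have hc' : -FinDivisor.ndeg F X.qPilot ≤
      (valLine F).lnνL X.lstar (primesUnder X) ((valLine F).hullUTheta (ind3Bare X)) := hc
  rw [hhull, hΘ] at hc'
  linarith

/-! ## 3. The proviso holds for `F = ℚ` (one place over each prime) -/

/-- Over a number field of degree one every prime has a single place over it (`Σ_{v|p} e_v f_v = 1`).
[folklore] -/
theorem placesOver_subsingleton_of_finrank_eq_one (hF : Module.finrank ℚ F = 1) (p : ℕ) [Fact p.Prime]
    (v w : placesOver F p) : v = w := by
  classical
  by_contra hvw
  have hsum := sum_localDegree F p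
  rw [hF] at hsum
  have h2 : localDegree F v.1 + localDegree F w.1 ≤ ∑ u ∈ placesOver F p, localDegree F u := by
    rw [← Finset.sum_pair (fun huw => hvw (Subtype.ext huw))]
    exact Finset.sum_le_sum_of_subset (by
      intro u hu
      rcases Finset.mem_insert.mp hu with rfl | hu
      · exact v.2
      · rw [Finset.mem_singleton.mp hu]; exact w.2)
  have := localDegree_pos F v.1
  have := localDegree_pos F w.1
  omega

/-! ## 4. Pilot data over `ℚ`, and the independence of (1.1) from the L-DH typing -/

/-- **Pilot data over `ℚ`**: `j_E := 1/5`, `S := {v₅}` a place over `5` (supplied by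
`placesOver_nonempty`, so no ideal is computed by hand), `l := 5`. [folklore] -/
theorem exists_pilotData_rat :
    ∃ X : PilotData ℚ, ∀ p ∈ primesUnder X, ∀ v w : placesOver ℚ p, v = w := by
  haveI : Fact (Nat.Prime 5) := ⟨Nat.prime_five⟩
  obtain ⟨v5, hv5⟩ := placesOver_nonempty ℚ 5
  haveI : v5.asIdeal.LiesOver (Ideal.span {(5 : ℤ)}) := (mem_placesOver_iff v5).mp hv5
  have hmem : (5 : 𝓞 ℚ) ∈ v5.asIdeal := by
    have h1 : (5 : ℤ) ∈ v5.asIdeal.under ℤ := by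
      rw [← Ideal.LiesOver.over (p := Ideal.span {(5 : ℤ)}) (P := v5.asIdeal)]
      exact Ideal.mem_span_singleton_self _
    rw [Ideal.under_def, Ideal.mem_comap] at h1
    simpa using h1
  have h5 : (5 : 𝓞 ℚ) ≠ 0 := by exact_mod_cast (show (5 : ℕ) ≠ 0 by norm_num)
  have hord : 0 < ord ℚ v5 ((5 : 𝓞 ℚ) : ℚ) := (ord_pos_iff_mem ℚ v5 (5 : 𝓞 ℚ) h5).mpr hmem
  have hneg : ∀ v ∈ ({v5} : Finset (HeightOneSpectrum (𝓞 ℚ))), ord ℚ v ((((5 : 𝓞 ℚ) : ℚ))⁻¹) < 0 := by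
    intro v hv
    rw [Finset.mem_singleton] at hv
    subst hv
    rw [ord_inv]
    omega
  refine ⟨⟨(((5 : 𝓞 ℚ) : ℚ))⁻¹, {v5}, Finset.singleton_nonempty v5, hneg, 5, Nat.prime_five, le_rfl⟩, ?_⟩
  intro p hp v w
  haveI : Fact p.Prime := ⟨primesUnder_prime _ p hp⟩
  exact placesOver_subsingleton_of_finrank_eq_one (Module.finrank_self ℚ) p v w

/-- **(1.1) is independent of the L-DH typing**: over `ℚ` there are Dupuy–Hilado data for which (1.1)
HOLDS and data (same pilot divisors, same packets, (Ind3)-datum without enlargement) for which it FAILS.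
So at this level the Corollary's content is exactly what (Ind3) and the hull do to `O_𝕃(−P_Θ)` — the
vacuity audit of `DHData`/`Cor312DH` (cell rule, LANA Rem. 8.2.1). [claim: Mochizuki2012, status: disputed] -/
theorem cor312DH_independent :
    ∃ X : PilotData ℚ, (shellWitness X).Cor312DH ∧ ¬ (bareWitness X).Cor312DH := by
  obtain ⟨X, hX⟩ := exists_pilotData_rat
  exact ⟨X, cor312DH_shellWitness X, not_cor312DH_bareWitness X hX⟩

end ValLine

end Summit.ABC.IUTFork

end
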